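import Mathlib
import Literature.Computability.Complexity.DescriptionLengthSpace
import Literature.Computability.MetaComplexity.Hirahara2020.ReadOnceBranchingPrograms
import HarnessLib

/-!
# Hirahara (ToC 2023) Thm. 1.13, second rendering: the YES side as description-length–charged
# linear-space machines `DSPACE(cn)/ₙ cn` (census D13), instead of junta-sized branching programs

Companion of `Hirahara2020/ReadOnceBranchingPrograms.lean` (census row R28: [Hirahara2023NonDisjoint,
§4.8, p. 44 L34–39] *"Restatement of Theorem 1.13. There exists a universal constant ρ > 0
satisfying the following."* — suppose that for some constants `α, β > 0` the non-disjoint promise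
problem `(DSPACE(n) vs S̃IZE(2^{αn}; 2^{−ραn}))` *"cannot be computed"* … *"by a read-once
co-nondeterministic branching program of size"* `N^{1+β}` *"for all large input length N ∈ ℕ. Then
there exists a hitting set generator"* … *"computable in O(log n) space and secure against
linear-size read-once branching programs."*; proof, p. 45 L7–13: *"Given arbitrary constants
c, α, β > 0"* … the promise problem is `(Π_YES, Π_NO) := (DSPACE(cn)/ₙ cn vs S̃IZE(2^{αn}; 2^{−ραn}))`
on inputs of length `N = 2ⁿ`). That file typed the theorem (`thm113`) with the YES side SHRUNK to
truth tables of functions with a deterministic branching program of `≤ cn/⌊log₂ n⌋` nodes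
(`smallBPYes c`) — a sub-class of print's `DSPACE(c'n)/ₙ c'n`, hence an admissible (weaker) fact,
but (referee finding F34) a QUALITATIVELY smaller one: such functions are `o(n)`-juntas, the typed
promise problem is disjoint, and its hypothesis is substantially stronger than print's.

THIS FILE re-types Thm. 1.13 with the YES side rendered by the census definition D13
(`Complexity/DescriptionLengthSpace.lean`): `dlYes c` = truth tables of `f ∈ DSPACEdl (cn) (cn) n`
— functions on `{0,1}ⁿ` computed in work space `≤ cn` by a bounded-hardware multi-stack space
machine of rendered description length `≤ cn` [Def. 4.7, p. 33]. This class contains, for all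
large `n`, the slices of every language decided by a bounded-hardware machine in linear space
(`Complexity.mem_DSPACEdl_of_decidesInSpace`; e.g. it is not confined to juntas), and it is still
a SUB-class of print's `DSPACE(c'n)/ₙ c'n` for a constant `c'` depending on `c` (D13 module
docstring, DIRECTION: intrinsic description length ≤ `U`-description length up to constants;
bounded hardware simulable in linear space). Since print's proof treats ARBITRARY `c`, shrinking
YES to the rendered family only re-indexes `c`; everything else (NO side `approxHardNo α ρ`,
programs `NondetBranchingProgram (2^n)` + `IsReadOnce` + dual-form `CoSolves`, size budget
`⌊N^{1+β}⌋`, conclusion `LogspaceHSGvsLinearROBP`, universal `ρ` outside) is IDENTICAL to the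
first rendering, so the direction ledger there applies verbatim and `thm113_dl` below is again
WEAKER-OR-EQUAL than print — and closer to it. The two renderings are not formally compared here
(an inclusion `smallBPYes c ⊆ dlYes c'` would need branching-program-evaluating machines; text).

PROVED: monotonicity in `ρ` (`Thm113HypothesisDL.mono_rho`), the consumer
`hsg_of_forall_small_rho_dl`, F1 (`truthTable_const_mem_dlYes`: YES inhabited at every length
`n` with `cn ≥ 2`; the NO side and the program class are those of the first rendering).
-/

namespace Literature.Computability.MetaComplexity.Hirahara2020

open _root_.Computability Filter Topology Finset
open Literature.Computability.Complexity Literature.Computability.MetaComplexity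
open UniversalMachine OliveiraPichSanthanam2019

/-- The YES side at exponent `n`, second rendering: truth tables of `f ∈ DSPACEdl (cn) (cn) n`
(census D13: bounded-hardware space machines of rendered description length `≤ cn` computing `f`
on `{0,1}ⁿ` in work space `≤ cn`). [cite: Hirahara2023NonDisjoint, Def. 4.7 (p. 33) and §4.8 (p. 45 L13)] -/
def dlYes (c : ℕ) : Set (List Bool) :=
  {x | ∃ (n : ℕ) (f : (Fin n → Bool) → Bool), x = truthTable f ∧ f ∈ DSPACEdl (c * n) (c * n) n}

/-- **The `c`-th member of `DSPACE(n) vs S̃IZE(2^{αn}; 2^{−ραn})`, second rendering** (YES =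
`dlYes c`, NO = `approxHardNo α ρ` of the first rendering): a NON-DISJOINT promise problem in
general. [cite: Hirahara2023NonDisjoint, Def. 4.10 (p. 34) and §4.8 (p. 45 L13)] -/
def DSPACEdlVsApproxSIZE (c : ℕ) (α ρ : ℝ) : PromiseProblem :=
  ⟨dlYes c, approxHardNo α ρ⟩

/-- **The hypothesis of Thm. 1.13, second rendering**, for `ρ, α, β` and the family index `c`:
for all large `n`, no read-once nondeterministic branching program on `N = 2^n` variables of size
`≤ ⌊N^{1+β}⌋` co-solves (dual form) the `c`-th member at length `N`.
[cite: Hirahara2023NonDisjoint, §4.8 Restatement of Thm. 1.13 (p. 44 L34–38)] -/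
def Thm113HypothesisDL (ρ α β : ℝ) (c : ℕ) : Prop :=
  ∀ᶠ n : ℕ in atTop, ∀ P : NondetBranchingProgram (2 ^ n), P.IsReadOnce →
    P.size ≤ powSize (1 + β) (2 ^ n) → ¬ P.CoSolves (DSPACEdlVsApproxSIZE c α ρ)

/-- **Thm. 1.13 (CCC Thm. 62), second rendering** (YES = description-length–charged linear-space
machines, D13; otherwise as `thm113`), vendored unproved as a `Prop`: there is a universal `ρ > 0`
such that for all `α, β > 0` and every family index `c`, the hypothesis `Thm113HypothesisDL ρ α β c`
yields a log-space hitting set generator secure against linear-size read-once branching programs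
(`LogspaceHSGvsLinearROBP`, the weak reading of the first rendering). WEAKER-OR-EQUAL than print
(module docstring). [cite: Hirahara2023NonDisjoint, Thm. 1.13 (p. 13; §4.8 Restatement p. 44 L34–39; proof p. 45)] -/
def thm113_dl : Prop :=
  ∃ ρ : ℝ, 0 < ρ ∧ ∀ α β : ℝ, 0 < α → 0 < β → ∀ c : ℕ,
    Thm113HypothesisDL ρ α β c → LogspaceHSGvsLinearROBP

/-! ### Structure: monotonicity in `ρ` and the consumer -/

/-- The second-rendering hypothesis is monotone in `ρ` (for `α ≥ 0`), exactly as the first.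
[folklore] -/
theorem Thm113HypothesisDL.mono_rho {ρ ρ' α β : ℝ} {c : ℕ} (hα : 0 ≤ α) (h : ρ ≤ ρ')
    (hyp : Thm113HypothesisDL ρ α β c) : Thm113HypothesisDL ρ' α β c := by
  filter_upwards [hyp] with n hn P hro hsz hsolves
  exact hn P hro hsz (hsolves.mono_no (approxHardNo_mono hα h))

/-- **Consumer**: from `thm113_dl` and the hypothesis for all small `ρ > 0` (fixed `α, β > 0`,
`c`), a log-space hitting set generator secure against linear-size read-once branching programs.
[cite: Hirahara2023NonDisjoint, Thm. 1.13 (p. 13 / p. 44)] -/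
theorem hsg_of_forall_small_rho_dl (hT : thm113_dl) {ρ₀ α β : ℝ} {c : ℕ} (hρ₀ : 0 < ρ₀)
    (hα : 0 < α) (hβ : 0 < β) (hyp : ∀ ρ : ℝ, 0 < ρ → ρ ≤ ρ₀ → Thm113HypothesisDL ρ α β c) :
    LogspaceHSGvsLinearROBP := by
  obtain ⟨ρ, hρ, h⟩ := hT
  refine h α β hα hβ c ?_
  rcases le_total ρ ρ₀ with hle | hle
  · exact hyp ρ hρ hle
  · exact (hyp ρ₀ hρ₀ le_rfl).mono_rho hα.le hle

/-! ### Non-vacuity (F1) -/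

/-- **(F1) Π_YES is inhabited at every length with `cn ≥ 2`**: the constant-`false` function is
computed by the tree's constant-answer machine (rendered description length `2`, work space `1`).
[folklore] -/
theorem truthTable_const_mem_dlYes {c n : ℕ} (h : 2 ≤ c * n) (α ρ : ℝ) :
    truthTable (fun _ : Fin n → Bool => false) ∈ (DSPACEdlVsApproxSIZE c α ρ).yes :=
  ⟨n, fun _ => false, rfl, const_mem_DSPACEdl false (le_trans (by norm_num) h) h n⟩

/-- Hence, for `c ≥ 1`, Π_YES of the `c`-th member is inhabited at every length `n ≥ 2`.
[folklore] -/
theorem dlYes_nonempty_of_le {c n : ℕ} (hc : 1 ≤ c) (hn : 2 ≤ n) (α ρ : ℝ) :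
    ∃ x ∈ (DSPACEdlVsApproxSIZE c α ρ).yes, x.length = 2 ^ n := by
  have h2 : 2 ≤ c * n := hn.trans (by simpa using Nat.mul_le_mul_right n hc)
  exact ⟨_, truthTable_const_mem_dlYes h2 α ρ, length_truthTable _⟩

/-- **(F1) more YES instances: uniform linear space.** If a bounded-hardware machine `M` decides a
language `L` in space `x ↦ c₀·|x| + c₀`, then at every length `n` with `descLen M ≤ c·n` and
`c₀·n + c₀ ≤ c·n` (i.e. all large `n` once `c > c₀`), the truth table of the length-`n` slice of
`L` is a YES instance of the `c`-th member — the rendered YES side is not confined to juntas.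
[folklore] -/
theorem truthTable_slice_mem_dlYes {M : SpaceMachine Bool Bool} {L : Language Bool} {c₀ : ℕ}
    (hM : M.HasBoundedHardware) (hd : DecidesInSpace M L (fun x => c₀ * x.length + c₀))
    {c n : ℕ} (hdesc : M.descLen ≤ c * n) (hsp : c₀ * n + c₀ ≤ c * n) (α ρ : ℝ) :
    truthTable (fun x : Fin n → Bool => L.boolIndicator (List.ofFn x)) ∈
      (DSPACEdlVsApproxSIZE c α ρ).yes :=
  ⟨n, _, rfl, mem_DSPACEdl_of_decidesInSpace hM hd (fun x hx => by subst hx; exact hsp) hdesc⟩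

end Literature.Computability.MetaComplexity.Hirahara2020
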